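import Summits.AtomisticToContinuum.Crystallization.Theorems.OverbindingBudgetAffineFarFieldCellTwist

/-!
# OverbindingBudget (2c) — part 27Vb-K(B2): the ideal `h`-cell (trapezo-rhombic dodecahedron) (lens-4 g95; r1673/r1681 S3 «27Vb-K ideal cells», ed.2 split)

Support file, pure analysis on `ℝ³ = EuclideanSpace ℝ (Fin 3)`, no atlas.  The REFERENCE CELL of an
hcp (`h`-letter) site and its moment data in the typed interface `IsMomentCell` of part 27Va-B — the
SAME data as the `k`-cell of part 27Vb-K(A), from the SAME named hypothesis (constants leaf 27Vb-K2,
r1681 (β1)) `hC : HasRadialMoments (rdCell 1) 16 24 (656/15)` and nothing else: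

* `trdCell h := Ψ⁻¹(rdCell h)` (`Ψ = halfTwist` of part (B1)): the closed upper half of the rhombic
  dodecahedron glued to the half-turned lower half (`trdCell_eq_union`); closed, bounded by `2h`,
  compact, measurable, star-shaped about the site `0 ∈ trdCell h`; invariant under the coordinate
  3-cycle (NOT centrally symmetric);
* TRANSFER `∫_{trdCell h} g = ∫_{rdCell h} g ∘ Ψ` ⇒ equal volume `16h³`, equal radial moments, equal
  axial moments — through the two pointwise invariants of `Ψ`, no half-cell bookkeeping;
* CENTROID `∫_{trdCell h} x = 0` (the 3-cycle puts it on the axis; its axial component is that of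
  `rdCell h`); EXACT SECOND MOMENTS `∫ x_i x_j = 8h⁵ δ_ij` (3-cycle ⇒ two parameters; trace `24h⁵` and
  axial moment `∫(Σx)² = 24h⁵` are shared with the `k`-cell, whose off-diagonal moments vanish);
* ★ `isMomentCell_trdCell`: `IsMomentCell (trdCell h) 0 (h²/2) 0 (3h³) (41/15·h⁴)`; at nearest-neighbour
  distance `ν` (`h = ν/(2√2)`): `IsMomentCell (trdCell (ν/(2√2))) 0 (ν²/16) 0 _ (41/960·ν⁴)`, volume
  `ν³/√2`, inside `closedBall 0 (ν/√2)`.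

The cubic Taylor term of an `h`-cell does not vanish by symmetry; it is carried by `cell_taylor_tau`
with the cubic clause of part 27Vb-K(C) `…FarFieldCellTRDCubic` (`τ(h) = (14/45)h³`).
-/

namespace Summit.AtomisticToContinuum.Crystallization.Theorems.OverbindingBudgetAffineFarFieldCellTRD

noncomputable section

open MeasureTheory Set
open scoped Pointwise
open Summit.AtomisticToContinuum.Crystallization.Theorems.OverbindingBudgetAffineFarFieldCellTaylor
open Summit.AtomisticToContinuum.Crystallization.Theorems.OverbindingBudgetAffineFarFieldCellSymm
open Summit.AtomisticToContinuum.Crystallization.Theorems.OverbindingBudgetAffineFarFieldCellRD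
open Summit.AtomisticToContinuum.Crystallization.Theorems.OverbindingBudgetAffineFarFieldCellTwist

local notation "E3" => EuclideanSpace ℝ (Fin 3)

/-! ### The ideal `h`-cell (trapezo-rhombic dodecahedron) -/

/-- support: the IDEAL `h`-CELL of half-width `h` about the origin, in the cubic frame of the tree's hcp
convention (`Literature…hcpInt`: in-plane neighbours of type `(1,-1,0)`, UPPER cap of type `(1,1,0)`,
LOWER cap of type `(-1,-1,-4)/3`, all `× ν/√2`): the TRAPEZO-RHOMBIC DODECAHEDRON obtained from the
rhombic dodecahedron `rdCell h` by keeping its closed upper half `x₀+x₁+x₂ ≥ 0` and replacing the lower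
half by its half-turn about the stacking axis (`halfTurn (-3,-3,0) = (-1,-1,-4)`): as a set,
`trdCell h = Ψ⁻¹(rdCell h)` for the half-twist `Ψ`.  It is NOT centrally symmetric. -/
def trdCell (h : ℝ) : Set E3 := halfTwist ⁻¹' rdCell h

/-- Membership in the `h`-cell: `x ∈ trdCell h ↔ Ψ x ∈ rdCell h`. -/
theorem mem_trdCell {h : ℝ} {x : E3} : x ∈ trdCell h ↔ halfTwist x ∈ rdCell h := Iff.rfl

/-- On the closed upper half-space the `h`-cell agrees with the `k`-cell. -/
theorem mem_trdCell_of_nonneg {h : ℝ} {x : E3} (hx : 0 ≤ axSumL x) :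
    x ∈ trdCell h ↔ x ∈ rdCell h := by
  rw [mem_trdCell, halfTwist_of_nonneg hx]

/-- On the open lower half-space the `h`-cell is the half-turned `k`-cell. -/
theorem mem_trdCell_of_neg {h : ℝ} {x : E3} (hx : axSumL x < 0) :
    x ∈ trdCell h ↔ halfTurn x ∈ rdCell h := by
  rw [mem_trdCell, halfTwist_of_neg hx]

/-- `Ψ⁻¹(trdCell h) = rdCell h` (the half-twist is an involution). -/
theorem halfTwist_preimage_trdCell (h : ℝ) : halfTwist ⁻¹' trdCell h = rdCell h := by
  ext x
  simp only [mem_preimage, mem_trdCell, halfTwist_halfTwist]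

/-- The two closed halves: `trdCell h = (rdCell h ∩ {0 ≤ Σx}) ∪ (halfTurn⁻¹(rdCell h) ∩ {Σx ≤ 0})`
(on the basal plane the half-turn is `x ↦ -x`, a symmetry of `rdCell h`). -/
theorem trdCell_eq_union (h : ℝ) :
    trdCell h = (rdCell h ∩ {x | 0 ≤ axSumL x}) ∪ (halfTurn ⁻¹' rdCell h ∩ {x | axSumL x ≤ 0}) := by
  ext x
  simp only [mem_union, mem_inter_iff, mem_setOf_eq, mem_preimage]
  by_cases hx : 0 ≤ axSumL x
  · rw [mem_trdCell_of_nonneg hx]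
    constructor
    · intro h'; exact Or.inl ⟨h', hx⟩
    · rintro (⟨h', -⟩ | ⟨h', h0⟩)
      · exact h'
      · have hz : axSumL x = 0 := le_antisymm h0 hx
        rwa [halfTurn_of_axSum_zero hz, neg_mem_rdCell_iff] at h'
  · have hx' : axSumL x < 0 := not_le.1 hx
    rw [mem_trdCell_of_neg hx']
    constructor
    · intro h'; exact Or.inr ⟨h', hx'.le⟩
    · rintro (⟨-, h0⟩ | ⟨h', -⟩)
      · exact absurd h0 hx
      · exact h'

/-- The `h`-cell is closed. -/
theorem isClosed_trdCell (h : ℝ) : IsClosed (trdCell h) := by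
  rw [trdCell_eq_union]
  exact ((isClosed_rdCell h).inter (isClosed_le continuous_const axSumL.continuous)).union
    (((isClosed_rdCell h).preimage halfTurn.continuous).inter
      (isClosed_le axSumL.continuous continuous_const))

/-- Every point of the `h`-cell has norm at most `2h`. -/
theorem norm_le_of_mem_trdCell {h : ℝ} (hh : 0 ≤ h) {x : E3} (hx : x ∈ trdCell h) : ‖x‖ ≤ 2 * h := by
  rw [← norm_halfTwist]
  exact norm_le_of_mem_rdCell hh hx

/-- The `h`-cell lies in the closed ball of radius `2h` about the site. -/
theorem trdCell_subset_closedBall {h : ℝ} (hh : 0 ≤ h) : trdCell h ⊆ Metric.closedBall 0 (2 * h) := by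
  intro x hx
  rw [Metric.mem_closedBall, dist_zero_right]
  exact norm_le_of_mem_trdCell hh hx

/-- The `h`-cell is compact. -/
theorem isCompact_trdCell {h : ℝ} (hh : 0 ≤ h) : IsCompact (trdCell h) :=
  Metric.isCompact_of_isClosed_isBounded (isClosed_trdCell h)
    (Metric.isBounded_closedBall.subset (trdCell_subset_closedBall hh))

/-- The `h`-cell is measurable. -/
theorem measurableSet_trdCell (h : ℝ) : MeasurableSet (trdCell h) :=
  (isClosed_trdCell h).measurableSet

/-- The site `0` belongs to its `h`-cell. -/
theorem zero_mem_trdCell {h : ℝ} (hh : 0 ≤ h) : (0 : E3) ∈ trdCell h := by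
  rw [mem_trdCell_of_nonneg (by simp)]
  exact zero_mem_rdCell hh

/-- `trdCell h` is star-shaped about the origin. -/
theorem starConvex_trdCell {h : ℝ} (hh : 0 ≤ h) : StarConvex ℝ (0 : E3) (trdCell h) := by
  intro y hy a b ha hb hab
  rw [smul_zero, zero_add]
  have hb1 : b ≤ 1 := by linarith
  have hs : axSumL (b • y) = b * axSumL y := by rw [map_smul, smul_eq_mul]
  by_cases hy0 : 0 ≤ axSumL y
  · rw [mem_trdCell_of_nonneg (by rw [hs]; positivity)]
    exact smul_mem_rdCell ((mem_trdCell_of_nonneg hy0).1 hy) hb hb1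
  · have hy0' : axSumL y < 0 := not_le.1 hy0
    rcases hb.eq_or_lt with rfl | hbpos
    · rw [zero_smul]; exact zero_mem_trdCell hh
    · rw [mem_trdCell_of_neg (by rw [hs]; exact mul_neg_of_pos_of_neg hbpos hy0'), map_smul]
      exact smul_mem_rdCell ((mem_trdCell_of_neg hy0').1 hy) hb hb1

/-! ### Transfer of integrals from `rdCell h` -/

/-- `∫_{trdCell h} g = ∫_{rdCell h} g ∘ Ψ`. -/
theorem setIntegral_trdCell {F : Type*} [NormedAddCommGroup F] [NormedSpace ℝ F] (g : E3 → F)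
    (h : ℝ) : ∫ x in trdCell h, g x = ∫ x in rdCell h, g (halfTwist x) := by
  rw [← setIntegral_preimage_halfTwist g (trdCell h), halfTwist_preimage_trdCell]

/-- The `h`-cell and the `k`-cell have the same volume. -/
theorem volume_trdCell (h : ℝ) : volume (trdCell h) = volume (rdCell h) := by
  have e := measurePreserving_halfTwist.measure_preimage (measurableSet_trdCell h).nullMeasurableSet
  rw [halfTwist_preimage_trdCell] at e
  exact e.symm

/-- The `h`-cell and the `k`-cell have the same radial moments. -/
theorem moment_trdCell (h : ℝ) (n : ℕ) : ∫ x in trdCell h, ‖x‖ ^ n = ∫ x in rdCell h, ‖x‖ ^ n := by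
  rw [setIntegral_trdCell]
  simp only [norm_halfTwist]

/-- The `h`-cell and the `k`-cell have the same axial second moment `∫ (x₀+x₁+x₂)²`. -/
theorem axial_moment_trdCell (h : ℝ) :
    ∫ x in trdCell h, (axSumL x) ^ 2 = ∫ x in rdCell h, (axSumL x) ^ 2 := by
  rw [setIntegral_trdCell]
  simp only [axSumL_halfTwist]

/-- The `h`-cell and the `k`-cell have the same axial first moment `∫ (x₀+x₁+x₂)`. -/
theorem axial_first_moment_trdCell (h : ℝ) :
    ∫ x in trdCell h, axSumL x = ∫ x in rdCell h, axSumL x := by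
  rw [setIntegral_trdCell]
  simp only [axSumL_halfTwist]

/-! ### Symmetry under the coordinate 3-cycle, centroid, second moments -/

/-- The `h`-cell is invariant under the coordinate 3-cycle (about the site `0`). -/
theorem trdCell_invariant_cyc (h : ℝ) : IsInvariantUnder (trdCell h) 0 cycIso := by
  intro x hx
  rw [sub_zero, zero_add, mem_trdCell, halfTwist_cycIso]
  simpa using rdCell_invariant_cyc h (halfTwist x) hx

/-- The `h`-cell is invariant under the inverse coordinate 3-cycle. -/
theorem trdCell_invariant_cyc_symm (h : ℝ) : IsInvariantUnder (trdCell h) 0 cycIso.symm := by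
  intro x hx
  rw [sub_zero, zero_add, mem_trdCell, halfTwist_cycIso_symm]
  simpa using rdCell_invariant_cyc_symm h (halfTwist x) hx

/-- **The centroid of the ideal `h`-cell is the origin** (3-cycle symmetry fixes the direction of the
centroid on the stacking axis; its axial component equals that of `rdCell h`, which vanishes). -/
theorem integral_id_trdCell {h : ℝ} (hh : 0 ≤ h) : ∫ x in trdCell h, x = 0 := by
  -- (i) the 3-cycle fixes the centroid
  have hcyc : cycIso (∫ x in trdCell h, x) = ∫ x in trdCell h, x := by
    have e := setIntegral_comp_inv (trdCell_invariant_cyc h) (trdCell_invariant_cyc_symm h)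
      (fun y : E3 => y)
    simp only [sub_zero, zero_add] at e
    have e2 : ∫ x in trdCell h, cycIso x = cycIso (∫ x in trdCell h, x) := by
      simpa using cycIso.toLinearIsometry.integral_comp_comm (μ := volume.restrict (trdCell h))
        (fun y : E3 => y)
    rw [← e2, e]
  have h10 : (∫ x in trdCell h, x) 1 = (∫ x in trdCell h, x) 0 := by
    have := congrArg (fun v : E3 => v 1) hcyc
    simpa [cycIso_apply_one] using this.symm
  have h02 : (∫ x in trdCell h, x) 0 = (∫ x in trdCell h, x) 2 := by
    have := congrArg (fun v : E3 => v 0) hcyc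
    simpa [cycIso_apply_zero] using this.symm
  -- (ii) the axial component vanishes
  have hax : axSumL (∫ x in trdCell h, x) = 0 := by
    have i1 : IntegrableOn (fun x : E3 => x) (trdCell h) :=
      continuous_id.continuousOn.integrableOn_compact (isCompact_trdCell hh)
    have i2 : IntegrableOn (fun x : E3 => x) (rdCell h) :=
      continuous_id.continuousOn.integrableOn_compact (isCompact_rdCell hh)
    rw [← axSumL.integral_comp_comm i1, axial_first_moment_trdCell,
      axSumL.integral_comp_comm i2, integral_id_rdCell, map_zero]
  rw [axSumL_apply] at hax
  ext i
  fin_cases i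
  · show (∫ x in trdCell h, x) 0 = (0 : E3) 0
    simp; linarith
  · show (∫ x in trdCell h, x) 1 = (0 : E3) 1
    simp; linarith
  · show (∫ x in trdCell h, x) 2 = (0 : E3) 2
    simp; linarith

/-- Off-diagonal second moments of `trdCell h` are cyclically equal. -/
theorem offdiag_cyc_trdCell (h : ℝ) :
    (∫ x in trdCell h, x 2 * x 0) = (∫ x in trdCell h, x 0 * x 1) ∧
    (∫ x in trdCell h, x 0 * x 1) = (∫ x in trdCell h, x 1 * x 2) := by
  constructor
  · have e := setIntegral_comp_inv (trdCell_invariant_cyc h) (trdCell_invariant_cyc_symm h)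
      (fun y : E3 => y 0 * y 1)
    simpa [cycIso_apply_zero, cycIso_apply_one] using e
  · have e := setIntegral_comp_inv (trdCell_invariant_cyc h) (trdCell_invariant_cyc_symm h)
      (fun y : E3 => y 1 * y 2)
    simpa [cycIso_apply_one, cycIso_apply_two] using e

/-- Diagonal second moments of `trdCell h` are equal. -/
theorem diag_cyc_trdCell (h : ℝ) :
    (∫ x in trdCell h, x 0 * x 0) = (∫ x in trdCell h, x 2 * x 2) ∧
    (∫ x in trdCell h, x 1 * x 1) = (∫ x in trdCell h, x 0 * x 0) := by
  have e := moment_diag_cyc (trdCell_invariant_cyc h) (trdCell_invariant_cyc_symm h)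
  simpa using e

/-- **Exact second moments of the ideal `h`-cell**: `∫ x_i x_j = 8h⁵ δ_ij` (under the shape constants),
the same as for `rdCell h`.  The 3-cycle leaves two free parameters (diagonal `a`, off-diagonal `b`);
the trace `3a = ∫‖x‖² = 24h⁵` and the axial moment `3a + 6b = ∫(x₀+x₁+x₂)² = 24h⁵` are shared with
`rdCell h` pointwise through the half-twist. -/
theorem second_moments_trdCell (hC : HasRadialMoments (rdCell 1) 16 24 (656 / 15)) {h : ℝ}
    (hh : 0 < h) (i j : Fin 3) :
    ∫ x in trdCell h, x i * x j = if i = j then 8 * h ^ 5 else 0 := by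
  have hKc := isCompact_trdCell hh.le
  have hRc := isCompact_rdCell hh.le
  have hci : ∀ i : Fin 3, Continuous fun x : E3 => x i := fun i => (EuclideanSpace.proj i).continuous
  have hintT : ∀ i j : Fin 3, IntegrableOn (fun x : E3 => x i * x j) (trdCell h) :=
    fun i j => ((hci i).mul (hci j)).continuousOn.integrableOn_compact hKc
  have hintR : ∀ i j : Fin 3, IntegrableOn (fun x : E3 => x i * x j) (rdCell h) :=
    fun i j => ((hci i).mul (hci j)).continuousOn.integrableOn_compact hRc
  -- polynomial identities, integrated
  have expand2 : ∀ x : E3, ‖x‖ ^ 2 = x 0 * x 0 + x 1 * x 1 + x 2 * x 2 := by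
    intro x; rw [EuclideanSpace.real_norm_sq_eq, Fin.sum_univ_three]; ring
  have expandA : ∀ x : E3, (axSumL x) ^ 2
      = (x 0 * x 0 + x 1 * x 1 + x 2 * x 2) + 2 * (x 0 * x 1 + x 1 * x 2 + x 2 * x 0) := by
    intro x; rw [axSumL_apply]; ring
  have splitD : ∀ (K : Set E3), (∀ i j : Fin 3, IntegrableOn (fun x : E3 => x i * x j) K) →
      (∫ x in K, (x 0 * x 0 + x 1 * x 1 + x 2 * x 2))
        = (∫ x in K, x 0 * x 0) + (∫ x in K, x 1 * x 1) + (∫ x in K, x 2 * x 2) := by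
    intro K hK
    have i1 := integral_add (hK 0 0) (hK 1 1)
    have i2 := integral_add ((hK 0 0).add (hK 1 1)) (hK 2 2)
    simp only [Pi.add_apply] at i2
    rw [i2, i1]
  have splitO : ∀ (K : Set E3), (∀ i j : Fin 3, IntegrableOn (fun x : E3 => x i * x j) K) →
      (∫ x in K, (x 0 * x 1 + x 1 * x 2 + x 2 * x 0))
        = (∫ x in K, x 0 * x 1) + (∫ x in K, x 1 * x 2) + (∫ x in K, x 2 * x 0) := by
    intro K hK
    have i1 := integral_add (hK 0 1) (hK 1 2)
    have i2 := integral_add ((hK 0 1).add (hK 1 2)) (hK 2 0)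
    simp only [Pi.add_apply] at i2
    rw [i2, i1]
  have splitA : ∀ (K : Set E3), (∀ i j : Fin 3, IntegrableOn (fun x : E3 => x i * x j) K) →
      (∫ x in K, (axSumL x) ^ 2) = ((∫ x in K, x 0 * x 0) + (∫ x in K, x 1 * x 1)
        + (∫ x in K, x 2 * x 2)) + 2 * ((∫ x in K, x 0 * x 1) + (∫ x in K, x 1 * x 2)
        + (∫ x in K, x 2 * x 0)) := by
    intro K hK
    simp_rw [expandA]
    have i3 := integral_add (((hK 0 0).add (hK 1 1)).add (hK 2 2))
      ((((hK 0 1).add (hK 1 2)).add (hK 2 0)).const_mul 2)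
    simp only [Pi.add_apply] at i3
    rw [i3, integral_const_mul, splitD K hK, splitO K hK]
  -- trace on both cells
  have trT : (∫ x in trdCell h, x 0 * x 0) + (∫ x in trdCell h, x 1 * x 1)
      + (∫ x in trdCell h, x 2 * x 2) = 24 * h ^ 5 := by
    rw [← splitD _ hintT]
    simp_rw [← expand2]
    rw [moment_trdCell, second_moment_rdCell hC hh]
  have trR : (∫ x in rdCell h, x 0 * x 0) + (∫ x in rdCell h, x 1 * x 1)
      + (∫ x in rdCell h, x 2 * x 2) = 24 * h ^ 5 := by
    rw [← splitD _ hintR]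
    simp_rw [← expand2]
    rw [second_moment_rdCell hC hh]
  -- axial moment on both cells
  have axT := splitA _ hintT
  have axR := splitA _ hintR
  rw [offdiag_rdCell h (by decide : (0 : Fin 3) ≠ 1), offdiag_rdCell h (by decide : (1 : Fin 3) ≠ 2),
    offdiag_rdCell h (by decide : (2 : Fin 3) ≠ 0), trR] at axR
  rw [axial_moment_trdCell, axR, trT] at axT
  obtain ⟨o20, o01⟩ := offdiag_cyc_trdCell h
  obtain ⟨d02, d10⟩ := diag_cyc_trdCell h
  have hoff : (∫ x in trdCell h, x 0 * x 1) = 0 := by linarith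
  have hd : (∫ x in trdCell h, x 0 * x 0) = 8 * h ^ 5 := by linarith
  have comm : ∀ i j : Fin 3, (∫ x in trdCell h, x i * x j) = ∫ x in trdCell h, x j * x i := by
    intro i j; congr 1; funext x; ring
  fin_cases i <;> fin_cases j
  · simpa using hd
  · simpa using hoff
  · simp; rw [comm]; linarith
  · simp; rw [comm]; linarith
  · simp; linarith
  · simp; linarith
  · simp; linarith
  · simp; rw [comm]; linarith
  · simp; linarith

/-- ★ **The ideal `h`-cell is a moment cell** with the SAME data as the `k`-cell: under the shape
constants of `rdCell 1`, for `0 < h`, `IsMomentCell (trdCell h) 0 (h²/2) 0 (3h³) (41/15·h⁴)` — centroid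
`0`, EXACT isotropy `δ = 0`, `σ = h²/2`, `μ₃ = 3h³`, `μ₄ = (41/15)h⁴`.  (No central symmetry: the cubic
Taylor term of an `h`-cell is handled by `cell_taylor_tau`, part 27Vb-K(C).) -/
theorem isMomentCell_trdCell (hC : HasRadialMoments (rdCell 1) 16 24 (656 / 15)) {h : ℝ}
    (hh : 0 < h) : IsMomentCell (trdCell h) 0 (h ^ 2 / 2) 0 (3 * h ^ 3) (41 / 15 * h ^ 4) := by
  have hKc := isCompact_trdCell hh.le
  have hvol : (volume (trdCell h)).toReal = 16 * h ^ 3 := by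
    rw [volume_trdCell, volume_rdCell hC hh]
  have hm : ∀ i j : Fin 3, |(∫ x in trdCell h, (x - 0) i * (x - 0) j)
      - h ^ 2 / 2 * (volume (trdCell h)).toReal * (if i = j then 1 else 0)|
        ≤ 0 * (volume (trdCell h)).toReal := by
    intro i j
    simp only [sub_zero, hvol, second_moments_trdCell hC hh, zero_mul]
    split_ifs <;> ring_nf <;> simp
  refine ⟨hKc, starConvex_trdCell hh.le, zero_mem_trdCell hh.le, le_rfl, ?_, ?_, ?_, ?_⟩
  · simpa using integral_id_trdCell hh.le
  · intro B
    have e := secondMoment_form_of_coords hKc hm B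
    simpa using e
  · simp only [sub_zero, hvol, moment_trdCell]
    calc ∫ x in rdCell h, ‖x‖ ^ 3 ≤ 48 * h ^ 6 := third_moment_rdCell_le hC hh
      _ = 3 * h ^ 3 * (16 * h ^ 3) := by ring
  · simp only [sub_zero, hvol, moment_trdCell]
    calc ∫ x in rdCell h, ‖x‖ ^ 4 ≤ 656 / 15 * h ^ 7 := fourth_moment_rdCell_le hC hh
      _ = 41 / 15 * h ^ 4 * (16 * h ^ 3) := by ring

/-! ### Nearest-neighbour units: `h = ν/(2√2)` -/

/-- ★ The ideal `h`-cell at nearest-neighbour distance `ν`: `σ = ν²/16`, `δ = 0`, `μ₄ = (41/960)ν⁴`. -/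
theorem isMomentCell_trdCell_nu (hC : HasRadialMoments (rdCell 1) 16 24 (656 / 15)) {ν : ℝ}
    (hν : 0 < ν) :
    IsMomentCell (trdCell (ν / (2 * Real.sqrt 2))) 0 (ν ^ 2 / 16) 0
      (3 * (ν / (2 * Real.sqrt 2)) ^ 3) (41 / 960 * ν ^ 4) := by
  have hs : 0 < 2 * Real.sqrt 2 := by positivity
  have hh : 0 < ν / (2 * Real.sqrt 2) := div_pos hν hs
  have e2 : (ν / (2 * Real.sqrt 2)) ^ 2 = ν ^ 2 / 8 := by
    rw [div_pow, mul_pow, Real.sq_sqrt (by norm_num : (0:ℝ) ≤ 2)]; norm_num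
  have e1 : ν ^ 2 / 16 = (ν / (2 * Real.sqrt 2)) ^ 2 / 2 := by rw [e2]; ring
  have e4' : (ν / (2 * Real.sqrt 2)) ^ 4 = ν ^ 4 / 64 := by
    rw [show (ν / (2 * Real.sqrt 2)) ^ 4 = ((ν / (2 * Real.sqrt 2)) ^ 2) ^ 2 by ring, e2]; ring
  have e4 : 41 / 960 * ν ^ 4 = 41 / 15 * (ν / (2 * Real.sqrt 2)) ^ 4 := by rw [e4']; ring
  rw [e1, e4]
  exact isMomentCell_trdCell hC hh

/-- The ideal `h`-cell at nearest-neighbour distance `ν` has volume `ν³/√2` (same as the `k`-cell). -/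
theorem volume_trdCell_nu (hC : HasRadialMoments (rdCell 1) 16 24 (656 / 15)) {ν : ℝ} (hν : 0 < ν) :
    (volume (trdCell (ν / (2 * Real.sqrt 2)))).toReal = ν ^ 3 / Real.sqrt 2 := by
  rw [volume_trdCell, volume_rdCell_nu hC hν]

/-- The ideal `h`-cell at nearest-neighbour distance `ν` lies in the closed ball of radius `ν/√2`. -/
theorem trdCell_nu_subset_closedBall {ν : ℝ} (hν : 0 ≤ ν) :
    trdCell (ν / (2 * Real.sqrt 2)) ⊆ Metric.closedBall 0 (ν / Real.sqrt 2) := by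
  have hs2 : 0 < Real.sqrt 2 := by positivity
  have hh : 0 ≤ ν / (2 * Real.sqrt 2) := by positivity
  have e : 2 * (ν / (2 * Real.sqrt 2)) = ν / Real.sqrt 2 := by field_simp
  rw [← e]
  exact trdCell_subset_closedBall hh

end

end Summit.AtomisticToContinuum.Crystallization.Theorems.OverbindingBudgetAffineFarFieldCellTRD
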